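import Literature.AlgebraicGeometry.Motives.HodgeStructureLefschetzGroupFieldExtension
import Literature.AlgebraicGeometry.Motives.HodgeStructureLefschetzGroupCenterGeometricPoints
import Mathlib.RingTheory.Artinian.Module
import HarnessLib

/-!
# THE CENTRE `C₀ ⊗ K` OF `C(H)(K)` ALONG A FIELD EXTENSION `K → L ⊇ ℚ`: THE INJECTIVE RING HOMOMORPHISM
# `Z(C(H)(K)) → Z(C(H)(L))` OVER `j : K ⊗ V → L ⊗ V`, AND `t_K ≤ t_L` — THE NUMBER OF SIMPLE FACTORS OF `C₀ ⊗ K` (MILNE'S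
# `F ⊗_ℚ k = F₁ × ⋯ × F_t`) NEVER DECREASES WHEN THE COEFFICIENT FIELD GROWS (Milne 1999 §1 Remark 1.6 «`C'(A) ≅ C(A) ⊗_k k'`»,
# p. 645 «`C₀(A)` is a product of fields», §2 p. 646 «`F ⊗_ℚ k = F₁ × ⋯ × F_t`, `1 = e₁ + ⋯ + e_t`»)

[topic AlgebraicGeometry/Motives]

Layer `Literature/AlgebraicGeometry/Motives`, lane `lit-hodgefound` (Track 2 foundations library; prover seat
`lit-hodgefound-p02`, generation 56, self-proposed row g56-#1). THEOREMS ONLY: no definition, no named fact (net debt `0`),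
no instance, no notation.  Milne's centralizer `C(A)` and its centre are objects over the coefficient field `k` of the Weil
cohomology, and Remark 1.6 records what happens along a field extension `k ⊆ k'`: «`C'(A) ≅ C(A) ⊗_k k'`, `S'(A) ≅ S(A)_{/k'}`».
In §2 (p. 646) the centre `F` of `End⁰(A)` is split by the coefficient field, `F ⊗_ℚ k = F₁ × ⋯ × F_t` with orthogonal idempotents
`1 = e₁ + ⋯ + e_t`, and the NUMBER `t = t_k` OF FACTORS DEPENDS ON `k`.  The tree has the `K`-points `C(H)(K)` (the commutant of
the `a_K`, `a ∈ E_φ`, in `End_K(K ⊗_ℚ V)`), its centre `Z_K = Z(C(H)(K)) = span_K {z_K | z ∈ C₀}` (g54-#2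
`toSubmodule_map_val_center_centralizer_endAlg_baseChange_eq_span`), `t_K = #MaxSpec(Z_K)` with `t_K ≤ dim_ℚ C₀` and equality iff
`K` splits `C₀` (g55-#9), and the extension of scalars `j : K ⊗_ℚ V → L ⊗_ℚ V` along `ℚ ⊆ K ⊆ L`
(`Motives/MumfordTateGroupFieldExtension`, `Motives/HodgeStructureLefschetzGroupFieldExtension`: `j (a_K x) = a_L (j x)`, `j`
injective).  Here, WITHOUT introducing a definition, the `L`-EXTENSION `F` of a `K`-endomorphism `f` of `K ⊗ V` is handled through
its characteristic property `F ∘ j = j ∘ f` (it exists, through `L ⊗_K (K ⊗_ℚ V) ≅ L ⊗_ℚ V`, and is unique because `L ⊗ V` is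
spanned over `L` by `j(K ⊗ V)`), and the following is PROVED for every `ℚ`-Hodge structure `H` on a finite-dimensional `V` and all
fields `ℚ ⊆ K ⊆ L` (any universes):
(i) LEMMA A (`K`-linear combinations of base changes extend to `L`-linear combinations of base changes): `f ∈ span_K {z_K | z ∈ S}`
⟹ `F ∈ span_L {z_L | z ∈ S}`, for every `S ⊆ End_ℚ(V)`; and `F` commutes with the `s_L` iff `f` commutes with the `s_K`;
(ii) `F ∈ C(H)(L) ⟺ f ∈ C(H)(K)`, and (polarizable `H`) `F ∈ Z(C(H)(L)) ⟺ f ∈ Z(C(H)(K))`;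
(iii) «`C'(A) ≅ C(A) ⊗_k k'`» ON THE CENTRES: an INJECTIVE RING HOMOMORPHISM `φ : Z(C(H)(K)) → Z(C(H)(L))` with `φ(z) ∘ j = j ∘ z`;
(iv) the idempotents: `Z_K` has exactly `2^{t_K}` idempotents (the `e_J = Σ_{i ∈ J} e_i`), and an injective ring homomorphism of
reduced finite-dimensional commutative algebras is injective on idempotents, so **`t_K ≤ t_L`** — with NO condition on the Rosati
involution (g55-#8's `t ≤ t_K` needed the first kind, going through the finite group `Z(S(H)(K))`);
(v) hence if `K` splits `C₀` (`t_K = dim_ℚ C₀`), so does every `L ⊇ K`.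

## The sources, verbatim

* J. S. Milne, *Lefschetz classes on abelian varieties*, Duke Math. J. 96 (1999) 639–675 [Milne1999LefschetzClasses] (held
  `paper:doi-10-1215-s0012-7094-99-09620-5`): folio 6 = p. 644 L30–L37 «**Remark 1.6.** If `X ↦ H*(X)` is a Weil cohomology
  theory with coefficient field `k`, and `k'` is a field containing `k`, then `X ↦ H*(X) ⊗_k k'` is a Weil cohomology theory with
  coefficient field `k'`. If `C'(A)` and `S'(A)` denote the objects defined relative to the second theory, then there are
  canonical isomorphisms `C'(A) ≅ C(A) ⊗_k k'`, `S'(A) ≅ S(A)_{/k'}`.»; folio 7 = p. 645 L2–L6 «let `C₀(A)` be the centre of the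
  `ℚ`-algebra `End⁰(A)` — it is a product of fields …»; folio 8 = p. 646 L33–L38 «Let `F ⊗_ℚ k = F₁ × ⋯ × F_t` be the
  decomposition of `F ⊗_ℚ k` into a product of fields, and let `1 = e₁ + ⋯ + e_t` be the corresponding decomposition of `1` into
  a sum of orthogonal idempotents. Then `V(A) = V₁ ⊕ ⋯ ⊕ V_t`, `V_i = e_i V`».
* P. Deligne, *Hodge cycles on abelian varieties*, LNM 900 (1982) [Deligne1982HodgeCycles], I §3.1 (algebraic groups over `ℚ`
  through their points in `ℚ`-algebras; extension of scalars in the proof of Prop. 3.1).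
* N. Bourbaki, *Algebra I* [BourbakiAlgebraI1989], Ch. II §5 no. 1 (extension of scalars of linear maps, `(1 ⊗ f)`), no. 3 Prop. 7
  (faithfulness over a field), §7 no. 7 (`L ⊗_K (K ⊗_ℚ V) = L ⊗_ℚ V`).
* R. S. Pierce, *Associative Algebras*, GTM 88 (1982) [Pierce1982], §10.7 Cor. b (a commutative semisimple finite-dimensional
  algebra is a finite product of fields; its idempotents).

Nearest tree results, BY NAME: `extendScalars_baseChange_apply`, `extendScalars_injective`
(`Motives/HodgeStructureLefschetzGroupFieldExtension`), `toSubmodule_map_val_center_centralizer_endAlg_baseChange_eq_span` (g54-#2),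
`isReduced_center_centralizer_endAlg_baseChange` (g55-#8), `natCard_maximalSpectrum_center_centralizer_le_finrank_center` ∕
`…_eq_finrank_center_iff` (g55-#9), `finrank_center_centralizer_endAlg_baseChange_eq` (g54-#6: `dim_K Z_K = dim_ℚ C₀`, the
numerical form of «`Z(C'(A)) = C₀ ⊗ k'`»).  NOT here: the `L`-algebra isomorphism `Z_K ⊗_K L ≅ Z_L` (the ring homomorphism of (iii)
and the dimension count of g54-#6 are its two shadows in the tree), and the group side `Z(S(H)(K)) ↪ Z(S(H)(L))` (row g56-#2).

## Dictionary and what is proved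

`j = extendScalars K L V`, `a_K = a.baseChange K`; "`F` extends `f`" = `∀ x, F (j x) = j (f x)`;
`C(H)(K) = Subalgebra.centralizer K {a_K | a ∈ E_φ}`, `Z_K = Subalgebra.center K C(H)(K)`, `t_K = Nat.card (MaximalSpectrum Z_K)`,
`C₀ = Subalgebra.center ℚ E_φ`.

* §1 (namespace `Literature.AlgebraicGeometry.Motives`) **`linearMap_ext_of_extendScalars`**, **`exists_linearMap_extendScalars_comm`**,
  **`linearMap_eq_of_extendScalars_comm`**, `extendScalars_smul_eq_algebraMap_smul`,
  **`mem_span_image_baseChange_of_extendScalars_comm`** (LEMMA A), **`forall_baseChange_comm_iff_of_extendScalars_comm`**,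
  **`mem_centralizer_image_baseChange_iff_of_extendScalars_comm`**, `mul_extendScalars_comm`,
  `eq_of_extendScalars_comm_of_extendScalars_comm`.
* §2∕§3 (namespace `…Motives.HodgeStructure`) **`natCard_isIdempotentElem_eq_two_pow_natCard_maximalSpectrum`** (reduced
  finite-dimensional commutative algebra: `2^{#MaxSpec}` idempotents), **`natCard_maximalSpectrum_le_of_ringHom_injective`**;
  **`mem_centralizer_endAlg_baseChange_iff_of_extendScalars_comm`** (`F ∈ C(H)(L) ↔ f ∈ C(H)(K)`),
  **`mem_center_centralizer_of_extendScalars_comm`**, **`mem_center_centralizer_iff_of_extendScalars_comm`**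
  (`F ∈ Z(C(H)(L)) ↔ f ∈ Z(C(H)(K))`), **`exists_center_centralizer_ringHom_injective`** (`Z_K ↪ Z_L` over `j`),
  **`natCard_maximalSpectrum_center_centralizer_le`** (`t_K ≤ t_L`),
  **`natCard_maximalSpectrum_center_centralizer_eq_finrank_center_of_eq`** (`t_K = dim_ℚ C₀ ⟹ t_L = dim_ℚ C₀`),
  **`natCard_isIdempotentElem_center_centralizer_eq_two_pow`** (`#{e ∈ Z_K | e² = e} = 2^{t_K}`),
  **`natCard_isIdempotentElem_center_centralizer_le`**.
-/

noncomputable section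

open scoped TensorProduct

namespace Literature.AlgebraicGeometry.Motives

universe u u' v

/-! ## §1 The `L`-extension of a `K`-endomorphism of `K ⊗_ℚ V` through its characteristic property `F ∘ j = j ∘ f` -/

section Plumbing

variable (K : Type u) (L : Type u') [Field K] [Field L] [Algebra ℚ K] [Algebra ℚ L] [Algebra K L]
  [IsScalarTower ℚ K L] (V : Type v) [AddCommGroup V] [Module ℚ V]

/-- **Two `L`-linear maps out of `L ⊗_ℚ V` agreeing on `j(K ⊗ V)` are equal** (`L ⊗ V` is spanned over `L` by the `j(1 ⊗ v)`).
[cite: BourbakiAlgebraI1989, Ch. II §7 no. 7 and §5 no. 1] -/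
theorem linearMap_ext_of_extendScalars {M : Type*} [AddCommGroup M] [Module L M] [Module ℚ M] [IsScalarTower ℚ L M]
    {F G : L ⊗[ℚ] V →ₗ[L] M}
    (h : ∀ x : K ⊗[ℚ] V, F (extendScalars K L V x) = G (extendScalars K L V x)) : F = G := by
  refine TensorProduct.AlgebraTensorModule.ext fun l v => ?_
  rw [show (l ⊗ₜ[ℚ] v : L ⊗[ℚ] V) = l • extendScalars K L V ((1 : K) ⊗ₜ[ℚ] v) by
      rw [extendScalars_one_tmul, TensorProduct.smul_tmul', smul_eq_mul, mul_one],
    map_smul, map_smul, h]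

/-- **EVERY `K`-ENDOMORPHISM `f` OF `K ⊗_ℚ V` HAS AN `L`-LINEAR EXTENSION `F` TO `L ⊗_ℚ V`, `F ∘ j = j ∘ f`** — the map
`1 ⊗ f` of `L ⊗_K (K ⊗_ℚ V)` read through `L ⊗_K (K ⊗_ℚ V) ≅ L ⊗_ℚ V` («`C'(A) ≅ C(A) ⊗_k k'`»: every element of `C(A) ⊗ k'` acts
on `V ⊗ k'`). [cite: BourbakiAlgebraI1989, Ch. II §5 no. 1 and §7 no. 7] [cite: Milne1999LefschetzClasses, §1 Remark 1.6 (p. 644)] -/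
theorem exists_linearMap_extendScalars_comm (f : Module.End K (K ⊗[ℚ] V)) :
    ∃ F : Module.End L (L ⊗[ℚ] V), ∀ x, F (extendScalars K L V x) = extendScalars K L V (f x) := by
  have hj : ∀ y : K ⊗[ℚ] V, extendScalars K L V y =
      TensorProduct.AlgebraTensorModule.cancelBaseChange ℚ K L L V ((1 : L) ⊗ₜ[K] y) := by
    intro y
    induction y using TensorProduct.induction_on with
    | zero => simp
    | tmul c v =>
      rw [extendScalars_tmul, TensorProduct.AlgebraTensorModule.cancelBaseChange_tmul, Algebra.smul_def, mul_one]
    | add y₁ y₂ h₁ h₂ => rw [map_add, h₁, h₂, TensorProduct.tmul_add, map_add]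
  refine ⟨(TensorProduct.AlgebraTensorModule.cancelBaseChange ℚ K L L V).toLinearMap ∘ₗ f.baseChange L ∘ₗ
    (TensorProduct.AlgebraTensorModule.cancelBaseChange ℚ K L L V).symm.toLinearMap, fun x => ?_⟩
  rw [hj, hj, LinearMap.comp_apply, LinearMap.comp_apply, LinearEquiv.coe_toLinearMap, LinearEquiv.coe_toLinearMap,
    LinearEquiv.symm_apply_apply, LinearMap.baseChange_tmul]

/-- **The `L`-extension is unique.** [cite: BourbakiAlgebraI1989, Ch. II §7 no. 7] -/
theorem linearMap_eq_of_extendScalars_comm {f : Module.End K (K ⊗[ℚ] V)} {F G : Module.End L (L ⊗[ℚ] V)}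
    (hF : ∀ x, F (extendScalars K L V x) = extendScalars K L V (f x))
    (hG : ∀ x, G (extendScalars K L V x) = extendScalars K L V (f x)) : F = G :=
  linearMap_ext_of_extendScalars K L V fun x => by rw [hF, hG]

/-- `j` is semilinear over `K → L`: `j (c • x) = (K → L)(c) • j x`. [cite: BourbakiAlgebraI1989, Ch. II §5 no. 1] -/
theorem extendScalars_smul_eq_algebraMap_smul (c : K) (x : K ⊗[ℚ] V) :
    extendScalars K L V (c • x) = algebraMap K L c • extendScalars K L V x := by
  rw [map_smul, algebraMap_smul]

/-- **LEMMA A — `K`-LINEAR COMBINATIONS OF BASE CHANGES EXTEND TO `L`-LINEAR COMBINATIONS OF BASE CHANGES**: if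
`f = Σ cᵢ (zᵢ)_K ∈ span_K {z_K | z ∈ S}` for a set `S ⊆ End_ℚ(V)` and `F` extends `f` (`F ∘ j = j ∘ f`), then
`F = Σ (K → L)(cᵢ) (zᵢ)_L ∈ span_L {z_L | z ∈ S}` (the two maps agree on `j(K ⊗ V)`).  With `S = C₀` resp. `S = E_φ` this is the
passage `C₀ ⊗ K → C₀ ⊗ L` resp. `E_φ ⊗ K → E_φ ⊗ L` inside `End(V ⊗ k')`. [cite: Milne1999LefschetzClasses, §1 Remark 1.6 (p. 644)]
[cite: Deligne1982HodgeCycles, I §3 Prop. 3.1 (proof: extension of scalars)] [cite: BourbakiAlgebraI1989, Ch. II §5 no. 1] -/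
theorem mem_span_image_baseChange_of_extendScalars_comm {S : Set (Module.End ℚ V)} {f : Module.End K (K ⊗[ℚ] V)}
    {F : Module.End L (L ⊗[ℚ] V)} (hF : ∀ x, F (extendScalars K L V x) = extendScalars K L V (f x))
    (hf : f ∈ Submodule.span K ((fun z : Module.End ℚ V => z.baseChange K) '' S)) :
    F ∈ Submodule.span L ((fun z : Module.End ℚ V => z.baseChange L) '' S) := by
  obtain ⟨l, hl, hlf⟩ := (Finsupp.mem_span_image_iff_linearCombination K (v := fun z : Module.End ℚ V => z.baseChange K)).1 hf
  set G : Module.End L (L ⊗[ℚ] V) := l.sum fun z c => algebraMap K L c • z.baseChange L with hGdef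
  have hGmem : G ∈ Submodule.span L ((fun z : Module.End ℚ V => z.baseChange L) '' S) := by
    refine Submodule.sum_mem _ fun z hz => Submodule.smul_mem _ _ (Submodule.subset_span ⟨z, hl ?_, rfl⟩)
    exact hz
  have hGext : ∀ x, G (extendScalars K L V x) = extendScalars K L V (f x) := by
    intro x
    rw [← hlf, Finsupp.linearCombination_apply, hGdef, Finsupp.sum, Finsupp.sum, LinearMap.sum_apply, LinearMap.sum_apply,
      map_sum]
    refine Finset.sum_congr rfl fun z _ => ?_
    rw [LinearMap.smul_apply, LinearMap.smul_apply, extendScalars_smul_eq_algebraMap_smul, extendScalars_baseChange_apply]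
  rwa [linearMap_eq_of_extendScalars_comm K L V hF hGext]

/-- **COMMUTATION WITH BASE-CHANGED RATIONAL ENDOMORPHISMS IS INSENSITIVE TO `K → L`**: for the `L`-extension `F` of `f` and any
`S ⊆ End_ℚ(V)`, `F` commutes with every `s_L` iff `f` commutes with every `s_K` (`s ∈ S`) — "⟸" on `j(K ⊗ V)`, which spans
`L ⊗ V`; "⟹" by the injectivity of `j`. [cite: Milne1999LefschetzClasses, §1 Remark 1.6 (p. 644)] [cite: BourbakiAlgebraI1989, Ch. II §5 no. 3 Prop. 7] -/
theorem forall_baseChange_comm_iff_of_extendScalars_comm {S : Set (Module.End ℚ V)} {f : Module.End K (K ⊗[ℚ] V)}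
    {F : Module.End L (L ⊗[ℚ] V)} (hF : ∀ x, F (extendScalars K L V x) = extendScalars K L V (f x)) :
    (∀ s ∈ S, F * s.baseChange L = s.baseChange L * F) ↔ (∀ s ∈ S, f * s.baseChange K = s.baseChange K * f) := by
  refine ⟨fun h s hs => LinearMap.ext fun x => extendScalars_injective K L V ?_, fun h s hs => ?_⟩
  · rw [Module.End.mul_apply, Module.End.mul_apply, ← hF, extendScalars_baseChange_apply, extendScalars_baseChange_apply,
      ← hF, ← Module.End.mul_apply (f := F), h s hs, Module.End.mul_apply]
  · refine linearMap_ext_of_extendScalars K L V fun x => ?_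
    rw [Module.End.mul_apply, Module.End.mul_apply, ← extendScalars_baseChange_apply, hF, hF,
      ← extendScalars_baseChange_apply, ← Module.End.mul_apply (f := f), h s hs, Module.End.mul_apply]

/-- **THE COMMUTANT OF `{s_K | s ∈ S}` AND OF `{s_L | s ∈ S}` CORRESPOND UNDER `f ↦ F`** (`S ⊆ End_ℚ(V)`).
[cite: Milne1999LefschetzClasses, §1 Remark 1.6 (p. 644)] [cite: BourbakiAlgebraI1989, Ch. II §5 no. 3 Prop. 7] -/
theorem mem_centralizer_image_baseChange_iff_of_extendScalars_comm {S : Set (Module.End ℚ V)}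
    {f : Module.End K (K ⊗[ℚ] V)} {F : Module.End L (L ⊗[ℚ] V)}
    (hF : ∀ x, F (extendScalars K L V x) = extendScalars K L V (f x)) :
    F ∈ Subalgebra.centralizer L ((fun s : Module.End ℚ V => s.baseChange L) '' S) ↔
      f ∈ Subalgebra.centralizer K ((fun s : Module.End ℚ V => s.baseChange K) '' S) := by
  rw [Subalgebra.mem_centralizer_iff, Subalgebra.mem_centralizer_iff, Set.forall_mem_image, Set.forall_mem_image]
  simp only [eq_comm (a := _ * F), eq_comm (a := _ * f)]
  exact forall_baseChange_comm_iff_of_extendScalars_comm K L V hF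

/-- **Extensions compose**: `F G` extends `f g`. [cite: BourbakiAlgebraI1989, Ch. II §5 no. 1] -/
theorem mul_extendScalars_comm {f g : Module.End K (K ⊗[ℚ] V)} {F G : Module.End L (L ⊗[ℚ] V)}
    (hF : ∀ x, F (extendScalars K L V x) = extendScalars K L V (f x))
    (hG : ∀ x, G (extendScalars K L V x) = extendScalars K L V (g x)) (x : K ⊗[ℚ] V) :
    (F * G) (extendScalars K L V x) = extendScalars K L V ((f * g) x) := by
  rw [Module.End.mul_apply, Module.End.mul_apply, hG, hF]

/-- **`f ↦ F` is injective**: one `F` extends at most one `f` (`j` is injective). [cite: BourbakiAlgebraI1989, Ch. II §5 no. 3 Prop. 7] -/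
theorem eq_of_extendScalars_comm_of_extendScalars_comm {f g : Module.End K (K ⊗[ℚ] V)} {F : Module.End L (L ⊗[ℚ] V)}
    (hF : ∀ x, F (extendScalars K L V x) = extendScalars K L V (f x))
    (hG : ∀ x, F (extendScalars K L V x) = extendScalars K L V (g x)) : f = g :=
  LinearMap.ext fun x => extendScalars_injective K L V (by rw [← hF, hG])

end Plumbing

namespace HodgeStructure

/-! ## §2 Algebra: the idempotents of a reduced finite-dimensional commutative algebra; injections do not decrease `#MaxSpec` -/

/-- In a commutative ring which is a field, `e² = e ⟹ e ∈ {0, 1}`. [folklore] -/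
private theorem eq_zero_or_eq_one_of_isIdempotentElem₅₆₁ {R : Type*} [CommRing R] (hR : IsField R) {e : R}
    (he : IsIdempotentElem e) : e = 0 ∨ e = 1 := by
  by_cases h : e = 0
  · exact Or.inl h
  · obtain ⟨w, hw⟩ := hR.mul_inv_cancel h
    refine Or.inr ?_
    calc e = e * (e * w) := by rw [hw, mul_one]
      _ = e * e * w := by rw [mul_assoc]
      _ = 1 := by rw [he.eq, hw]

/-- **ZERO-ONE VECTORS IN A PRODUCT OF FIELDS**: along `ζ : Z ≃+* Π_{k : ι} F_k` with every `F_k` a field, the idempotents of `Z` are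
exactly the `2^{#ι}` indicator vectors `e_J`, `J ⊆ ι`. [folklore] -/
private theorem natCard_isIdempotentElem_eq_two_pow₅₆₁ {Z : Type*} [CommRing Z] {ι : Type*} [Fintype ι] {F : ι → Type*}
    [∀ k, CommRing (F k)] (ζ : Z ≃+* Π k, F k) (hF : ∀ k, IsField (F k)) :
    Nat.card {e : Z // IsIdempotentElem e} = 2 ^ Fintype.card ι := by
  classical
  have h01 : ∀ (e : {e : Z // IsIdempotentElem e}) (k : ι), ζ e.1 k = 0 ∨ ζ e.1 k = 1 := fun e k =>
    eq_zero_or_eq_one_of_isIdempotentElem₅₆₁ (hF k) (by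
      change ζ e.1 k * ζ e.1 k = ζ e.1 k
      rw [← Pi.mul_apply, ← ζ.map_mul, e.2.eq])
  -- `e ↦` its indicator vector is a bijection onto `ι → Bool`
  let σ : {e : Z // IsIdempotentElem e} → (ι → Bool) := fun e k => decide (ζ e.1 k = 1)
  have hinj : Function.Injective σ := by
    intro e e' h
    apply Subtype.ext
    apply ζ.injective
    funext k
    have hk : (ζ e.1 k = 1 ↔ ζ e'.1 k = 1) := decide_eq_decide.1 (congr_fun h k)
    have hne : ∀ k, (0 : F k) ≠ 1 := fun k => by
      haveI := (hF k).nontrivial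
      exact zero_ne_one
    rcases h01 e k with h1 | h1 <;> rcases h01 e' k with h2 | h2
    · rw [h1, h2]
    · exact absurd (hk.2 h2) (by rw [h1]; exact hne k)
    · exact absurd (hk.1 h1) (by rw [h2]; exact hne k)
    · rw [h1, h2]
  have hsurj : Function.Surjective σ := by
    intro s
    refine ⟨⟨ζ.symm fun k => bif s k then 1 else 0, ζ.injective ?_⟩, funext fun k => ?_⟩
    · rw [ζ.map_mul, ζ.apply_symm_apply]
      funext k
      rw [Pi.mul_apply]
      cases s k <;> simp
    · change decide (ζ (ζ.symm fun k => bif s k then 1 else 0) k = 1) = s k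
      rw [ζ.apply_symm_apply]
      cases hsk : s k
      · haveI := (hF k).nontrivial
        simp only [cond_false, decide_eq_false_iff_not]
        exact zero_ne_one
      · simp only [cond_true, decide_true]
  rw [Nat.card_congr (Equiv.ofBijective σ ⟨hinj, hsurj⟩), Nat.card_eq_fintype_card, Fintype.card_fun, Fintype.card_bool]

/-- **A REDUCED FINITE-DIMENSIONAL COMMUTATIVE `K`-ALGEBRA `Z` HAS EXACTLY `2^{#MaxSpec(Z)}` IDEMPOTENTS** (`Z ≅ Π_𝔪 Z/𝔪` is a finite
product of fields, Mathlib's `IsArtinianRing.equivPi`; the idempotents are the indicator vectors of the sets of factors).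
[cite: Pierce1982, §10.7 Cor. b] -/
theorem natCard_isIdempotentElem_eq_two_pow_natCard_maximalSpectrum (K : Type u) [Field K] (Z : Type*) [CommRing Z]
    [Algebra K Z] [Module.Finite K Z] [IsReduced Z] :
    Finite (MaximalSpectrum Z) ∧ Nat.card {e : Z // IsIdempotentElem e} = 2 ^ Nat.card (MaximalSpectrum Z) := by
  classical
  haveI : IsArtinianRing Z := IsArtinianRing.of_finite K Z
  haveI := Fintype.ofFinite (MaximalSpectrum Z)
  refine ⟨inferInstance, ?_⟩
  rw [Nat.card_eq_fintype_card (α := MaximalSpectrum Z)]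
  exact natCard_isIdempotentElem_eq_two_pow₅₆₁ (IsArtinianRing.equivPi Z).toRingEquiv
    fun I => (Ideal.Quotient.maximal_ideal_iff_isField_quotient I.asIdeal).1 I.isMaximal

/-- **AN INJECTIVE RING HOMOMORPHISM `Z → Z'` OF REDUCED FINITE-DIMENSIONAL COMMUTATIVE ALGEBRAS DOES NOT DECREASE THE NUMBER OF
SIMPLE FACTORS: `#MaxSpec(Z) ≤ #MaxSpec(Z')`** — it is injective on idempotents, so `2^{t} ≤ 2^{t'}`. [cite: Pierce1982, §10.7 Cor. b] -/
theorem natCard_maximalSpectrum_le_of_ringHom_injective (K : Type u) [Field K] (K' : Type u') [Field K'] (Z : Type*)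
    [CommRing Z] [Algebra K Z] [Module.Finite K Z] [IsReduced Z] (Z' : Type*) [CommRing Z'] [Algebra K' Z']
    [Module.Finite K' Z'] [IsReduced Z'] (φ : Z →+* Z') (hφ : Function.Injective φ) :
    Nat.card (MaximalSpectrum Z) ≤ Nat.card (MaximalSpectrum Z') := by
  have hZ := (natCard_isIdempotentElem_eq_two_pow_natCard_maximalSpectrum K Z).2
  have hZ' := (natCard_isIdempotentElem_eq_two_pow_natCard_maximalSpectrum K' Z').2
  haveI : Finite {e : Z' // IsIdempotentElem e} :=
    Nat.finite_of_card_ne_zero (by rw [hZ']; exact pow_ne_zero _ two_ne_zero)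
  have hle : Nat.card {e : Z // IsIdempotentElem e} ≤ Nat.card {e : Z' // IsIdempotentElem e} :=
    Nat.card_le_card_of_injective (fun e => ⟨φ e.1, e.2.map φ⟩) fun e e' h =>
      Subtype.ext (hφ (congrArg Subtype.val h))
  rw [hZ, hZ'] at hle
  exact (pow_le_pow_iff_right₀ (by norm_num : (1 : ℕ) < 2)).1 hle


/-! ## §3 «`C'(A) ≅ C(A) ⊗_k k'`» on the centres: `Z(C(H)(K)) ↪ Z(C(H)(L))` over `j`, and `t_K ≤ t_L` -/

section Centre

variable (K : Type u) (L : Type u') [Field K] [Field L] [Algebra ℚ K] [Algebra ℚ L] [Algebra K L]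
  [IsScalarTower ℚ K L] {V : Type v} [AddCommGroup V] [Module ℚ V] [Module.Finite ℚ V] {n : ℤ} (H : HodgeStructure V n)

omit [Module.Finite ℚ V] in
/-- **`F ∈ C(H)(L) ⟺ f ∈ C(H)(K)`** for the `L`-extension `F` of `f` — the `K`-points of Milne's centralizer are the `L`-points
defined over `K` («`C'(A) ≅ C(A) ⊗_k k'`» on points). [cite: Milne1999LefschetzClasses, §1 Remark 1.6 (p. 644) and p. 643 L1–L3 (`C(A)`)] -/
theorem mem_centralizer_endAlg_baseChange_iff_of_extendScalars_comm {f : Module.End K (K ⊗[ℚ] V)}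
    {F : Module.End L (L ⊗[ℚ] V)} (hF : ∀ x, F (extendScalars K L V x) = extendScalars K L V (f x)) :
    F ∈ Subalgebra.centralizer L ((fun a : Module.End ℚ V => a.baseChange L) '' (H.endAlg : Set (Module.End ℚ V))) ↔
      f ∈ Subalgebra.centralizer K ((fun a : Module.End ℚ V => a.baseChange K) '' (H.endAlg : Set (Module.End ℚ V))) :=
  mem_centralizer_image_baseChange_iff_of_extendScalars_comm K L V hF

set_option maxSynthPendingDepth 4 in
/-- **`f ∈ Z(C(H)(K)) ⟹ F ∈ Z(C(H)(L))`** (polarizable `H`): `Z(C(H)(K)) = span_K {z_K | z ∈ C₀}` and `Z(C(H)(L)) = span_L {z_L | z ∈ C₀}`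
(g54-#2 «`Z(C'(A)) = C₀(A) ⊗_k k'`»), and LEMMA A carries the one span to the other — the map `C₀ ⊗ K → C₀ ⊗ L`.
[cite: Milne1999LefschetzClasses, §1 Remark 1.6 (p. 644) and p. 645 L2–L6 (`C₀`)] [cite: Deligne1982HodgeCycles, I §3 Prop. 3.1 (proof)] -/
theorem mem_center_centralizer_of_extendScalars_comm (hH : H.IsPolarizable) {f : Module.End K (K ⊗[ℚ] V)}
    {F : Module.End L (L ⊗[ℚ] V)} (hF : ∀ x, F (extendScalars K L V x) = extendScalars K L V (f x))
    (hf : f ∈ Subalgebra.centralizer K ((fun a : Module.End ℚ V => a.baseChange K) '' (H.endAlg : Set (Module.End ℚ V))))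
    (hfz : (⟨f, hf⟩ : Subalgebra.centralizer K ((fun a : Module.End ℚ V => a.baseChange K) ''
        (H.endAlg : Set (Module.End ℚ V)))) ∈
      Subalgebra.center K (Subalgebra.centralizer K
        ((fun a : Module.End ℚ V => a.baseChange K) '' (H.endAlg : Set (Module.End ℚ V))))) :
    (⟨F, (mem_centralizer_endAlg_baseChange_iff_of_extendScalars_comm K L H hF).2 hf⟩ :
        Subalgebra.centralizer L ((fun a : Module.End ℚ V => a.baseChange L) '' (H.endAlg : Set (Module.End ℚ V)))) ∈
      Subalgebra.center L (Subalgebra.centralizer L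
        ((fun a : Module.End ℚ V => a.baseChange L) '' (H.endAlg : Set (Module.End ℚ V)))) := by
  -- `f ∈ span_K {z_K | z ∈ C₀}` ⟹ `F ∈ span_L {z_L | z ∈ C₀}` (Lemma A), and these spans are the centres (g54-#2)
  have hfspan : f ∈ Submodule.span K ((fun z : Module.End ℚ V => z.baseChange K) ''
      ((H.endAlg ⊓ Subalgebra.centralizer ℚ (H.endAlg : Set (Module.End ℚ V)) :
        Subalgebra ℚ (Module.End ℚ V)) : Set (Module.End ℚ V))) := by
    rw [← toSubmodule_map_val_center_centralizer_endAlg_baseChange_eq_span K H hH, Subalgebra.mem_toSubmodule,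
      Subalgebra.mem_map]
    exact ⟨_, hfz, rfl⟩
  have hFspan := mem_span_image_baseChange_of_extendScalars_comm K L V hF hfspan
  rw [← toSubmodule_map_val_center_centralizer_endAlg_baseChange_eq_span L H hH, Subalgebra.mem_toSubmodule,
    Subalgebra.mem_map] at hFspan
  obtain ⟨z, hz, hzF⟩ := hFspan
  have hz' : z = ⟨F, (mem_centralizer_endAlg_baseChange_iff_of_extendScalars_comm K L H hF).2 hf⟩ := Subtype.ext hzF
  rwa [hz'] at hz

set_option maxSynthPendingDepth 4 in
/-- **`F ∈ Z(C(H)(L)) ⟺ f ∈ Z(C(H)(K))`** (polarizable `H`): "⟹" because every `c ∈ C(H)(K)` has an extension `C ∈ C(H)(L)`, and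
`F C = C F` restricts along the injective `j` to `f c = c f`. [cite: Milne1999LefschetzClasses, §1 Remark 1.6 (p. 644) and p. 645 L2–L6 (`C₀`)] -/
theorem mem_center_centralizer_iff_of_extendScalars_comm (hH : H.IsPolarizable) {f : Module.End K (K ⊗[ℚ] V)}
    {F : Module.End L (L ⊗[ℚ] V)} (hF : ∀ x, F (extendScalars K L V x) = extendScalars K L V (f x))
    (hf : f ∈ Subalgebra.centralizer K ((fun a : Module.End ℚ V => a.baseChange K) '' (H.endAlg : Set (Module.End ℚ V)))) :
    (⟨F, (mem_centralizer_endAlg_baseChange_iff_of_extendScalars_comm K L H hF).2 hf⟩ :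
        Subalgebra.centralizer L ((fun a : Module.End ℚ V => a.baseChange L) '' (H.endAlg : Set (Module.End ℚ V)))) ∈
      Subalgebra.center L (Subalgebra.centralizer L
        ((fun a : Module.End ℚ V => a.baseChange L) '' (H.endAlg : Set (Module.End ℚ V)))) ↔
    (⟨f, hf⟩ : Subalgebra.centralizer K ((fun a : Module.End ℚ V => a.baseChange K) ''
        (H.endAlg : Set (Module.End ℚ V)))) ∈
      Subalgebra.center K (Subalgebra.centralizer K
        ((fun a : Module.End ℚ V => a.baseChange K) '' (H.endAlg : Set (Module.End ℚ V)))) := by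
  refine ⟨fun h => ?_, mem_center_centralizer_of_extendScalars_comm K L H hH hF hf⟩
  rw [Subalgebra.mem_center_iff]
  intro c
  obtain ⟨C, hC⟩ := exists_linearMap_extendScalars_comm K L V (c : Module.End K (K ⊗[ℚ] V))
  have hCmem := (mem_centralizer_endAlg_baseChange_iff_of_extendScalars_comm K L H hC).2 c.2
  have hcomm := Subalgebra.mem_center_iff.1 h ⟨C, hCmem⟩
  refine Subtype.ext (eq_of_extendScalars_comm_of_extendScalars_comm K L V
    (mul_extendScalars_comm K L V hC hF) ?_)
  intro x
  have h' : C * F = F * C := congrArg Subtype.val hcomm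
  rw [h']
  exact mul_extendScalars_comm K L V hF hC x


set_option maxSynthPendingDepth 4 in
/-- The standing instance on `Z_K`: finite-dimensional over `K`. [folklore] -/
private theorem finite_center_centralizer₅₆₁ :
    Module.Finite K (Subalgebra.center K (Subalgebra.centralizer K
      ((fun a : Module.End ℚ V => a.baseChange K) '' (H.endAlg : Set (Module.End ℚ V))))) := by
  haveI := finite_centralizer_endAlg_baseChange K H
  haveI : IsNoetherian K (Subalgebra.centralizer K
      ((fun a : Module.End ℚ V => a.baseChange K) '' (H.endAlg : Set (Module.End ℚ V)))) :=
    isNoetherian_of_isNoetherianRing_of_finite K _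
  exact Module.Finite.of_injective (Subalgebra.val _).toLinearMap Subtype.val_injective

set_option maxSynthPendingDepth 4 in
/-- **«`C'(A) ≅ C(A) ⊗_k k'`» ON THE CENTRES: AN INJECTIVE RING HOMOMORPHISM `φ : Z(C(H)(K)) → Z(C(H)(L))` OVER `j`**
(polarizable `H`) — `φ(z)` is the `L`-extension of `z` (`φ(z) ∘ j = j ∘ z`, which determines it), a ring homomorphism by the
uniqueness of extensions and injective by the injectivity of `j`: the inclusion `C₀ ⊗ K ↪ C₀ ⊗ L`.  (Stated as an existence because
the file introduces no definition; `(φ z).1.1` is the underlying `L`-endomorphism of `L ⊗ V`.)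
[cite: Milne1999LefschetzClasses, §1 Remark 1.6 (p. 644) and p. 645 L2–L6 (`C₀`)] [cite: BourbakiAlgebraI1989, Ch. II §5 no. 1 and no. 3 Prop. 7] -/
theorem exists_center_centralizer_ringHom_injective (hH : H.IsPolarizable) :
    ∃ φ : Subalgebra.center K (Subalgebra.centralizer K
        ((fun a : Module.End ℚ V => a.baseChange K) '' (H.endAlg : Set (Module.End ℚ V)))) →+*
      Subalgebra.center L (Subalgebra.centralizer L
        ((fun a : Module.End ℚ V => a.baseChange L) '' (H.endAlg : Set (Module.End ℚ V)))),
      Function.Injective φ ∧ ∀ z x,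
        ((φ z).1.1 : Module.End L (L ⊗[ℚ] V)) (extendScalars K L V x) = extendScalars K L V ((z.1.1 : Module.End K (K ⊗[ℚ] V)) x) := by
  have key : ∀ z : Subalgebra.center K (Subalgebra.centralizer K
      ((fun a : Module.End ℚ V => a.baseChange K) '' (H.endAlg : Set (Module.End ℚ V)))),
      ∃ w : Subalgebra.center L (Subalgebra.centralizer L
        ((fun a : Module.End ℚ V => a.baseChange L) '' (H.endAlg : Set (Module.End ℚ V)))),
        ∀ x, (w.1.1 : Module.End L (L ⊗[ℚ] V)) (extendScalars K L V x) = extendScalars K L V ((z.1.1 : Module.End K (K ⊗[ℚ] V)) x) := by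
    intro z
    obtain ⟨F, hF⟩ := exists_linearMap_extendScalars_comm K L V (z.1.1 : Module.End K (K ⊗[ℚ] V))
    exact ⟨⟨⟨F, (mem_centralizer_endAlg_baseChange_iff_of_extendScalars_comm K L H hF).2 z.1.2⟩,
      mem_center_centralizer_of_extendScalars_comm K L H hH hF z.1.2 z.2⟩, hF⟩
  choose Φ hΦ using key
  have hext : ∀ {z : Subalgebra.center K (Subalgebra.centralizer K
      ((fun a : Module.End ℚ V => a.baseChange K) '' (H.endAlg : Set (Module.End ℚ V))))}
      {w : Subalgebra.center L (Subalgebra.centralizer L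
        ((fun a : Module.End ℚ V => a.baseChange L) '' (H.endAlg : Set (Module.End ℚ V))))},
      (∀ x, (w.1.1 : Module.End L (L ⊗[ℚ] V)) (extendScalars K L V x) = extendScalars K L V ((z.1.1 : Module.End K (K ⊗[ℚ] V)) x)) →
        Φ z = w :=
    fun {z} {w} hw => Subtype.ext (Subtype.ext (linearMap_eq_of_extendScalars_comm K L V (hΦ z) hw))
  refine ⟨{ toFun := Φ,
            map_one' := hext fun x => by simp,
            map_mul' := fun z z' => hext fun x => ?_,
            map_zero' := hext fun x => by simp,
            map_add' := fun z z' => hext fun x => ?_ }, fun z z' h => ?_, fun z x => hΦ z x⟩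
  · change (Φ z).1.1 ((Φ z').1.1 (extendScalars K L V x)) = extendScalars K L V (z.1.1 (z'.1.1 x))
    rw [hΦ, hΦ]
  · change (Φ z).1.1 (extendScalars K L V x) + (Φ z').1.1 (extendScalars K L V x) = extendScalars K L V (z.1.1 x + z'.1.1 x)
    rw [hΦ, hΦ, map_add]
  · refine Subtype.ext (Subtype.ext (eq_of_extendScalars_comm_of_extendScalars_comm K L V (hΦ z) ?_))
    intro x
    change (Φ z).1.1 (extendScalars K L V x) = _
    rw [show Φ z = Φ z' from h, hΦ]

set_option maxSynthPendingDepth 4 in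
/-- **`t_K ≤ t_L` ALONG EVERY FIELD EXTENSION `ℚ ⊆ K ⊆ L` — NO CONDITION ON THE ROSATI INVOLUTION** (polarizable `H`): the number
of simple factors of `C₀ ⊗ K = Z(C(H)(K))` (Milne's `t` in «`F ⊗_ℚ k = F₁ × ⋯ × F_t`», which depends on the coefficient field `k`)
can only grow with `k` — each factor `F_i` of `C₀ ⊗ K` splits further into the simple factors of `F_i ⊗_K L`.  Proof: the
injective ring homomorphism `Z_K ↪ Z_L` (previous statement) is injective on idempotents, `2^{t_K} ≤ 2^{t_L}` (§2).  (g55-#8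
`Polarization.natCard_minimal_stable_le_natCard_maximalSpectrum` is `t = t_ℚ ≤ t_K` under the first kind, through the finite
groups `Z(S(H)(·))`; here unconditionally and for any `K ⊆ L`.)
[cite: Milne1999LefschetzClasses, §1 Remark 1.6 (p. 644), p. 645 L2–L6 and §2 p. 646 L33–L38 (`F ⊗_ℚ k = F₁ × ⋯ × F_t`)] [cite: Pierce1982, §10.7 Cor. b] -/
theorem natCard_maximalSpectrum_center_centralizer_le (hH : H.IsPolarizable) :
    Nat.card (MaximalSpectrum (Subalgebra.center K (Subalgebra.centralizer K
        ((fun a : Module.End ℚ V => a.baseChange K) '' (H.endAlg : Set (Module.End ℚ V)))))) ≤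
      Nat.card (MaximalSpectrum (Subalgebra.center L (Subalgebra.centralizer L
        ((fun a : Module.End ℚ V => a.baseChange L) '' (H.endAlg : Set (Module.End ℚ V)))))) := by
  haveI := finite_center_centralizer₅₆₁ K H
  haveI := finite_center_centralizer₅₆₁ L H
  haveI := isReduced_center_centralizer_endAlg_baseChange K hH
  haveI := isReduced_center_centralizer_endAlg_baseChange L hH
  obtain ⟨φ, hφ, -⟩ := exists_center_centralizer_ringHom_injective K L H hH
  exact natCard_maximalSpectrum_le_of_ringHom_injective K L _ _ φ hφ

set_option maxSynthPendingDepth 4 in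
/-- **IF `K` SPLITS THE CENTRE `C₀`, SO DOES EVERY FIELD `L ⊇ K`: `t_K = dim_ℚ C₀ ⟹ t_L = dim_ℚ C₀`** (`t_K ≤ t_L ≤ dim_ℚ C₀`,
the upper bound being g55-#9 `natCard_maximalSpectrum_center_centralizer_le_finrank_center`) — e.g. every `K` containing the
Galois closures of the factors of `C₀`. [cite: Milne1999LefschetzClasses, §1 Remark 1.6 (p. 644) and §2 p. 646 L33–L38] -/
theorem natCard_maximalSpectrum_center_centralizer_eq_finrank_center_of_eq (hH : H.IsPolarizable)
    (hK : Nat.card (MaximalSpectrum (Subalgebra.center K (Subalgebra.centralizer K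
        ((fun a : Module.End ℚ V => a.baseChange K) '' (H.endAlg : Set (Module.End ℚ V)))))) =
      Module.finrank ℚ (Subalgebra.center ℚ H.endAlg)) :
    Nat.card (MaximalSpectrum (Subalgebra.center L (Subalgebra.centralizer L
        ((fun a : Module.End ℚ V => a.baseChange L) '' (H.endAlg : Set (Module.End ℚ V)))))) =
      Module.finrank ℚ (Subalgebra.center ℚ H.endAlg) :=
  le_antisymm (natCard_maximalSpectrum_center_centralizer_le_finrank_center L hH)
    (hK ▸ natCard_maximalSpectrum_center_centralizer_le K L H hH)

set_option maxSynthPendingDepth 4 in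
/-- **`C(H)(K)` HAS EXACTLY `2^{t_K}` CENTRAL IDEMPOTENTS** (polarizable `H`): the sums `e_J = Σ_{i ∈ J} e_i` over the sets `J` of
factors of `C₀ ⊗ K = F₁ × ⋯ × F_{t_K}` («`1 = e₁ + ⋯ + e_t` … orthogonal idempotents»); they cut `K ⊗ V` into the blocks
`V_J = ⊕_{i ∈ J} V_i`. [cite: Milne1999LefschetzClasses, §2 p. 646 L33–L38 and §1 p. 645 L2–L6] [cite: Pierce1982, §10.7 Cor. b] -/
theorem natCard_isIdempotentElem_center_centralizer_eq_two_pow (hH : H.IsPolarizable) :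
    Nat.card {e : Subalgebra.center K (Subalgebra.centralizer K
        ((fun a : Module.End ℚ V => a.baseChange K) '' (H.endAlg : Set (Module.End ℚ V)))) // IsIdempotentElem e} =
      2 ^ Nat.card (MaximalSpectrum (Subalgebra.center K (Subalgebra.centralizer K
        ((fun a : Module.End ℚ V => a.baseChange K) '' (H.endAlg : Set (Module.End ℚ V)))))) := by
  haveI := finite_center_centralizer₅₆₁ K H
  haveI := isReduced_center_centralizer_endAlg_baseChange K hH
  exact (natCard_isIdempotentElem_eq_two_pow_natCard_maximalSpectrum K _).2

set_option maxSynthPendingDepth 4 in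
/-- **THE CENTRAL IDEMPOTENTS DO NOT DECREASE ALONG `K → L`**: `#{e ∈ Z(C(H)(K)) | e² = e} = 2^{t_K} ≤ 2^{t_L} = #{e ∈ Z(C(H)(L)) | e² = e}`.
[cite: Milne1999LefschetzClasses, §1 Remark 1.6 (p. 644) and §2 p. 646 L33–L38] -/
theorem natCard_isIdempotentElem_center_centralizer_le (hH : H.IsPolarizable) :
    Nat.card {e : Subalgebra.center K (Subalgebra.centralizer K
        ((fun a : Module.End ℚ V => a.baseChange K) '' (H.endAlg : Set (Module.End ℚ V)))) // IsIdempotentElem e} ≤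
      Nat.card {e : Subalgebra.center L (Subalgebra.centralizer L
        ((fun a : Module.End ℚ V => a.baseChange L) '' (H.endAlg : Set (Module.End ℚ V)))) // IsIdempotentElem e} := by
  rw [natCard_isIdempotentElem_center_centralizer_eq_two_pow K H hH, natCard_isIdempotentElem_center_centralizer_eq_two_pow L H hH]
  exact Nat.pow_le_pow_right two_pos (natCard_maximalSpectrum_center_centralizer_le K L H hH)

end Centre

end HodgeStructure

end Literature.AlgebraicGeometry.Motives
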